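import Summits.NavierStokesRegularity.FunctionalMining.StretchingWrapFlow
import Literature.Analysis.FunctionSpaces.TorusEnstrophyOrthogonality
import Literature.Analysis.FluidPDE.TorusStrainVorticityIsometry
import Literature.Analysis.FluidPDE.ExtremeGrowthVorticityControlProofs
import HarnessLib

/-!
# K1-Q1, the wrap identity bound (bank blueprint N1) — part 2: the wrap case analysis

Cell `pub-nsfunc`, prove seat gen 5, on `WRAP-KERNEL-BLUEPRINT.md` §2 / dictionary node `WrapIdentityBound`.
**Search for candidate a priori estimates; no regularity claim.** Static field facts only;
nothing is asserted about Navier–Stokes solutions or their regularity.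

This part: (§4) derivatives of locally vanishing fields vanish; the strain boxes `boxPlus 2δ`, `boxMinus 2δ` are
disjoint; (§5) the purely algebraic wrap case analysis on `3×3` gradient matrices `X = G + P + M`
(`G` = gradient of `V₂`; cases: `a = b = 1 ∧ M = 0`, `a = b = −1 ∧ P = 0`, `P = M = 0`):
`prodBC X = 2κ((ω_P)₁² − (ω_P)₂²) − 2κ((ω_M)₁² − (ω_M)₂²) + prodBC P + prodBC M`,
`|ω_X|² = 4κ²(b−a)² + |ω_P|² + |ω_M|²`, `|ω_X|² ≤ 1`; (§6) general identities on `T³`: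
`σ(v) = ∫ prodBC(∇v)` (orthogonality form + Betchov), `2ℰ(v) = ∫|ω_v|²`, `T_ii(v) = ∫(ω_v)ᵢ²`;
(§7) the glued field `u = V₂ + u₊ + u₋`: smooth, divergence free, `∇u = ∇V₂ + ∇u₊ + ∇u₋`, and the case split at
every point.
-/

noncomputable section

open MeasureTheory Set Filter Topology Function
open scoped InnerProductSpace ContDiff

namespace Summit.NavierStokesRegularity.FunctionalMining

open Literature.Analysis Literature.Analysis.FunctionSpaces Literature.Analysis.FunctionSpaces.Torus
open Literature.Analysis.FluidPDE Literature.Analysis.FluidPDE.Torus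

namespace WrapStretching

open CellularStretching

/-! ## 4. Support bookkeeping: derivatives of locally vanishing fields; the two boxes are disjoint -/

/-- **If `f` vanishes on an open set containing `x`, all its partial derivatives vanish at `x`.** [folklore] -/
theorem partialDeriv_eq_zero_of_vanish {F : Type*} [NormedAddCommGroup F] [NormedSpace ℝ F]
    {f : UnitAddTorus (Fin 3) → F} {U : Set (UnitAddTorus (Fin 3))} (hU : IsOpen U) (hf : ∀ y ∈ U, f y = 0)
    {x : UnitAddTorus (Fin 3)} (hx : x ∈ U) (j : Fin 3) : Torus.partialDeriv j f x = 0 := by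
  unfold Torus.partialDeriv Torus.lineDeriv
  have hcont : Continuous fun t : ℝ => x + proj (t • EuclideanSpace.single j (1 : ℝ)) :=
    continuous_const.add (continuous_proj.comp (continuous_id.smul continuous_const))
  have h0 : (fun t : ℝ => x + proj (t • EuclideanSpace.single j (1 : ℝ))) 0 = x := by
    simp [proj_zero]
  have hmem : ∀ᶠ t in 𝓝 (0 : ℝ), x + proj (t • EuclideanSpace.single j (1 : ℝ)) ∈ U := by
    have hx' : U ∈ 𝓝 (x + proj ((0 : ℝ) • EuclideanSpace.single j (1 : ℝ))) := by
      rw [zero_smul, proj_zero, add_zero]; exact hU.mem_nhds hx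
    exact hcont.continuousAt.preimage_mem_nhds hx'
  have hev : (fun t : ℝ => f (x + proj (t • EuclideanSpace.single j (1 : ℝ)))) =ᶠ[𝓝 0] fun _ => (0 : F) :=
    hmem.mono fun t ht => hf _ ht
  rw [hev.deriv_eq, deriv_const]

/-- **The two strain boxes are disjoint** (`δ > 0`, `δ < 1/16`): the arcs `[2δ, ½ − 2δ]` and its translate by `½`
do not meet. [ours; elementary] -/
theorem not_mem_boxMinus_of_mem_boxPlus {δ : ℝ} (hδ : 0 < δ) (hδ' : δ < 1 / 16) {x : UnitAddTorus (Fin 3)}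
    (hx : x ∈ boxPlus (2 * δ)) : x ∉ boxMinus (2 * δ) := by
  intro hm
  obtain ⟨t, ht, hte⟩ := hx.1
  obtain ⟨s, hs, hse⟩ := hm.1
  -- `↑s = ↑t + ↑(1/2)`, both representatives in `[0,1)`
  have h1 : ((s : ℝ) : UnitAddCircle) = (((t + 1 / 2 : ℝ)) : UnitAddCircle) := by
    rw [hse, ← hte, AddCircle.coe_add]
  rw [AddCircle.coe_eq_coe_iff_of_mem_Ico (hp := ⟨zero_lt_one⟩) (a := 0)] at h1
  · linarith [hs.2, ht.1]
  · constructor <;> linarith [hs.1, hs.2]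
  · constructor <;> linarith [ht.1, ht.2]

/-- Outside the (closed) `+` box, `u₊` has vanishing derivatives. [ours; elementary] -/
theorem partialDeriv_eq_zero_of_not_mem_boxPlus {δ : ℝ} {f : UnitAddTorus (Fin 3) → EuclideanSpace ℝ (Fin 3)}
    (hf : ∀ y ∉ boxPlus δ, f y = 0) {x : UnitAddTorus (Fin 3)} (hx : x ∉ boxPlus δ) (j : Fin 3) :
    Torus.partialDeriv j f x = 0 :=
  partialDeriv_eq_zero_of_vanish (isClosed_boxPlus δ).isOpen_compl (fun y hy => hf y hy) hx j

/-- Outside the (closed) `−` box, `u₋` has vanishing derivatives. [ours; elementary] -/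
theorem partialDeriv_eq_zero_of_not_mem_boxMinus {δ : ℝ} {f : UnitAddTorus (Fin 3) → EuclideanSpace ℝ (Fin 3)}
    (hf : ∀ y ∉ boxMinus δ, f y = 0) {x : UnitAddTorus (Fin 3)} (hx : x ∉ boxMinus δ) (j : Fin 3) :
    Torus.partialDeriv j f x = 0 :=
  partialDeriv_eq_zero_of_vanish (isClosed_boxMinus δ).isOpen_compl (fun y hy => hf y hy) hx j

/-! ## 5. The wrap case analysis (pure algebra on `3 × 3` gradient matrices) -/

/-- Vorticity vector of a gradient matrix `X i j = ∂ⱼuᵢ`: `(X₂₁ − X₁₂, X₀₂ − X₂₀, X₁₀ − X₀₁)`. [ours; bookkeeping] -/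
def vort (X : Fin 3 → Fin 3 → ℝ) : Fin 3 → ℝ := ![X 2 1 - X 1 2, X 0 2 - X 2 0, X 1 0 - X 0 1]

/-- The production density in orthogonality form: `tr X³ − ∑ₘᵢ X_im ∑ⱼ X_jm X_ji` (`= ωᵀSω` for trace-free `X`).
[ours; bookkeeping] -/
def prodBC (X : Fin 3 → Fin 3 → ℝ) : ℝ :=
  (∑ i, ∑ j, ∑ k, X i j * X j k * X k i) - ∑ m, ∑ i, X i m * ∑ j, X j m * X j i

/-- The gradient of the diagonal crossed-shear flow at a point with slopes `a = Q'(x₁+x₂)`, `b = Q'(x₁−x₂)`: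
`G i j = κ a n_{A,j} τ_{A,i} + κ b n_{B,j} τ_{B,i}`. [ours; bookkeeping] -/
def gradV2 (κ a b : ℝ) (i j : Fin 3) : ℝ :=
  κ * (diagCoeff 1 1 j * a) * (if i = 1 then 1 else if i = 2 then -1 else 0) +
    κ * (diagCoeff 1 (-1) j * b) * (if i = 1 then 1 else if i = 2 then 1 else 0)

/-- **The wrap case analysis.** Let `X = G + P + M` with `G = gradV2 κ a b` and either (`a = b = 1`, `M = 0`), or
(`a = b = −1`, `P = 0`), or (`P = 0`, `M = 0`). Then
`prodBC X = 2κ((ω_P)₁² − (ω_P)₂²) − 2κ((ω_M)₁² − (ω_M)₂²) + prodBC P + prodBC M` and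
`|ω_X|² = 4κ²(b − a)² + |ω_P|² + |ω_M|²`. [ours] -/
theorem wrap_cases {κ a b : ℝ} {P M : Fin 3 → Fin 3 → ℝ}
    (H : (a = 1 ∧ b = 1 ∧ M = 0) ∨ (a = -1 ∧ b = -1 ∧ P = 0) ∨ (P = 0 ∧ M = 0)) :
    prodBC (fun i j => gradV2 κ a b i j + P i j + M i j) =
        2 * κ * (vort P 1 ^ 2 - vort P 2 ^ 2) - 2 * κ * (vort M 1 ^ 2 - vort M 2 ^ 2) + prodBC P + prodBC M ∧
      ∑ i, vort (fun i j => gradV2 κ a b i j + P i j + M i j) i ^ 2 =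
        4 * κ ^ 2 * (b - a) ^ 2 + ∑ i, vort P i ^ 2 + ∑ i, vort M i ^ 2 := by
  rcases H with ⟨ha, hb, hM⟩ | ⟨ha, hb, hP⟩ | ⟨hP, hM⟩
  · subst ha; subst hb; subst hM
    constructor
    · simp only [prodBC, vort, gradV2, diagCoeff, Fin.sum_univ_three, Pi.zero_apply]
      simp
      ring
    · simp only [vort, gradV2, diagCoeff, Fin.sum_univ_three, Pi.zero_apply]
      simp
  · subst ha; subst hb; subst hP
    constructor
    · simp only [prodBC, vort, gradV2, diagCoeff, Fin.sum_univ_three, Pi.zero_apply]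
      simp
      ring
    · simp only [vort, gradV2, diagCoeff, Fin.sum_univ_three, Pi.zero_apply]
      simp
  · subst hP; subst hM
    constructor
    · simp only [prodBC, vort, gradV2, diagCoeff, Fin.sum_univ_three, Pi.zero_apply]
      simp
      ring
    · simp only [vort, gradV2, diagCoeff, Fin.sum_univ_three, Pi.zero_apply]
      simp
      ring

/-- **The sup bound**: under the same case split, `|a|, |b| ≤ 1`, `16κ² ≤ 1`, `|ω_P|² ≤ 1`, `|ω_M|² ≤ 1` give
`|ω_X|² ≤ 1`. [ours; elementary] -/
theorem wrap_vort_le_one {κ a b : ℝ} {P M : Fin 3 → Fin 3 → ℝ}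
    (H : (a = 1 ∧ b = 1 ∧ M = 0) ∨ (a = -1 ∧ b = -1 ∧ P = 0) ∨ (P = 0 ∧ M = 0))
    (ha : |a| ≤ 1) (hb : |b| ≤ 1) (hκ : 16 * κ ^ 2 ≤ 1)
    (hP : ∑ i, vort P i ^ 2 ≤ 1) (hM : ∑ i, vort M i ^ 2 ≤ 1) :
    ∑ i, vort (fun i j => gradV2 κ a b i j + P i j + M i j) i ^ 2 ≤ 1 := by
  rw [(wrap_cases H).2]
  have hvP0 : ∑ i, vort (0 : Fin 3 → Fin 3 → ℝ) i ^ 2 = 0 := by simp [vort, Fin.sum_univ_three]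
  rcases H with ⟨rfl, rfl, rfl⟩ | ⟨rfl, rfl, rfl⟩ | ⟨rfl, rfl⟩
  · rw [hvP0]; linarith
  · rw [hvP0]; linarith
  · rw [hvP0]
    have h1 := abs_le.1 ha; have h2 := abs_le.1 hb
    have hab : (b - a) ^ 2 ≤ 4 := by nlinarith
    nlinarith

/-! ## 6. General identities: `σ(v) = ∫ prodBC(∇v)`, `2ℰ(v) = ∫|ω|²`, vorticity components -/

/-- The gradient matrix `X i j = ∂ⱼvᵢ(x)` of a field at a point. [ours; bookkeeping] -/
def gradAt (v : UnitAddTorus (Fin 3) → EuclideanSpace ℝ (Fin 3)) (x : UnitAddTorus (Fin 3)) (i j : Fin 3) : ℝ :=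
  Torus.partialDeriv j v x i

/-- `vorticityComp v x = vort (gradAt v x)`. [ours; bookkeeping] -/
theorem vorticityComp_eq_vort (v : UnitAddTorus (Fin 3) → EuclideanSpace ℝ (Fin 3)) (x : UnitAddTorus (Fin 3)) :
    vorticityComp v x = vort (gradAt v x) := rfl

/-- Entries of the gradient matrix of a smooth field are continuous. [folklore] -/
theorem continuous_gradAt {v : UnitAddTorus (Fin 3) → EuclideanSpace ℝ (Fin 3)} (hv : IsSmooth v) (i j : Fin 3) :
    Continuous fun x => gradAt v x i j :=
  ((hv.partialDeriv j).apply i).continuous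

/-- `x ↦ prodBC(∇v(x))` is continuous for smooth `v`. [folklore] -/
theorem continuous_prodBC_gradAt {v : UnitAddTorus (Fin 3) → EuclideanSpace ℝ (Fin 3)} (hv : IsSmooth v) :
    Continuous fun x => prodBC (gradAt v x) := by
  have hc := continuous_gradAt hv
  simp only [prodBC, Fin.sum_univ_three]
  fun_prop

/-- `x ↦ (ω_v(x))ᵢ` is continuous for smooth `v`. [folklore] -/
theorem continuous_vort_gradAt {v : UnitAddTorus (Fin 3) → EuclideanSpace ℝ (Fin 3)} (hv : IsSmooth v) (i : Fin 3) :
    Continuous fun x => vort (gradAt v x) i := by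
  have hc := continuous_gradAt hv
  fin_cases i <;> simp [vort] <;> fun_prop

/-- **`σ(v) = ∫ prodBC(∇v)`** for smooth divergence-free `v` on `T³` (orthogonality form of the production,
`Torus.integral_inner_laplacian_convect_self_eq_neg`, plus Betchov `∫tr(∇v)³ = 0`). [ours] -/
theorem enstrophyProduction_eq_integral_prodBC {v : UnitAddTorus (Fin 3) → EuclideanSpace ℝ (Fin 3)}
    (hv : IsSmooth v) (hdiv : IsDivFree v) :
    enstrophyProduction v = ∫ x, prodBC (gradAt v x) := by
  have hc : ∀ i j : Fin 3, Continuous fun x => Torus.partialDeriv j v x i := fun i j => continuous_gradAt hv i j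
  have hBi : Integrable (fun x : UnitAddTorus (Fin 3) => ∑ i, ∑ j, ∑ k, Torus.partialDeriv j v x i *
      Torus.partialDeriv k v x j * Torus.partialDeriv i v x k) volume :=
    (continuous_finsetSum _ fun i _ => continuous_finsetSum _ fun j _ => continuous_finsetSum _ fun k _ =>
      ((hc i j).mul (hc j k)).mul (hc k i)).integrable_unitAddTorus
  have hCi : Integrable (fun x : UnitAddTorus (Fin 3) => ∑ m, ∑ i, Torus.partialDeriv m v x i *
      ⟪Torus.partialDeriv m v x, Torus.partialDeriv i v x⟫_ℝ) volume :=
    (continuous_finsetSum _ fun m _ => continuous_finsetSum _ fun i _ =>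
      (hc i m).mul ((hv.partialDeriv m).continuous.inner (hv.partialDeriv i).continuous)).integrable_unitAddTorus
  have hcomm : enstrophyProduction v = ∫ x, ⟪Torus.laplacian v x, Torus.convect v v x⟫_ℝ := by
    unfold enstrophyProduction
    exact congrArg (fun f : UnitAddTorus (Fin 3) → ℝ => ∫ x, f x)
      (funext fun x => real_inner_comm (Torus.laplacian v x) (Torus.convect v v x))
  have horth := Torus.integral_inner_laplacian_convect_self_eq_neg hv hdiv
  have hBet := integral_sum_partialDeriv_cube_eq_zero hv hdiv
  rw [hcomm, horth, ← zero_sub, ← hBet, ← integral_sub hBi hCi]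
  refine integral_congr_ae (ae_of_all _ fun x => ?_)
  have hin : ∀ w w' : EuclideanSpace ℝ (Fin 3), ⟪w, w'⟫_ℝ = w 0 * w' 0 + w 1 * w' 1 + w 2 * w' 2 :=
    fun w w' => by simp [PiLp.inner_apply, Fin.sum_univ_three, mul_comm]
  simp only [prodBC, gradAt, hin, Fin.sum_univ_three]

/-- **`2ℰ(v) = ∫ |ω_v|² = ∫ ∑ᵢ vort(∇v)ᵢ²`** for smooth divergence-free `v` on `T³`. [ours] -/
theorem two_mul_torusEnstrophy_eq_integral_vort {v : UnitAddTorus (Fin 3) → EuclideanSpace ℝ (Fin 3)}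
    (hv : IsSmooth v) (hdiv : IsDivFree v) :
    2 * torusEnstrophy v = ∫ x, ∑ i, vort (gradAt v x) i ^ 2 := by
  rw [← integral_torusVorticitySqAt_eq_two_mul_torusEnstrophy hv hdiv]
  refine integral_congr_ae (ae_of_all _ fun x => ?_)
  show torusVorticitySqAt v x = ∑ i, vort (gradAt v x) i ^ 2
  rw [torusVorticitySqAt_eq_sum_sq, vorticityComp_eq_vort]

/-- **`T_ii(v) = ∫ vort(∇v)ᵢ²`.** [ours; bookkeeping] -/
theorem vorticityMoment_eq (v : UnitAddTorus (Fin 3) → EuclideanSpace ℝ (Fin 3)) (i : Fin 3) :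
    vorticityMoment v i i = ∫ x, vort (gradAt v x) i ^ 2 := by
  unfold vorticityMoment
  refine integral_congr_ae (ae_of_all _ fun x => ?_)
  show vorticityComp v x i * vorticityComp v x i = vort (gradAt v x) i ^ 2
  rw [vorticityComp_eq_vort, sq]

/-! ## 7. The glued field `u = V₂ + u₊ + u₋`: pointwise structure -/

/-- Sums of smooth divergence-free fields on `T³` are divergence free (trace of the derivative of the lift
is additive; proof pattern of the tree's `CP25…isDivFree_add'`). [folklore] -/
private theorem isDivFree_add₃ {u v : UnitAddTorus (Fin 3) → EuclideanSpace ℝ (Fin 3)} (hu : IsSmooth u) (hv : IsSmooth v)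
    (hu0 : IsDivFree u) (hv0 : IsDivFree v) : IsDivFree (u + v) := by
  have hu1 : IsContDiff 1 u := hu.isContDiff (by simp)
  have hv1 : IsContDiff 1 v := hv.isContDiff (by simp)
  have huv1 : IsContDiff 1 (u + v) := (hu.add hv).isContDiff (by simp)
  rw [isDivFree_iff_trace_fderiv_lift huv1]
  rw [isDivFree_iff_trace_fderiv_lift hu1] at hu0
  rw [isDivFree_iff_trace_fderiv_lift hv1] at hv0
  intro y
  have hl : Torus.lift (u + v) = Torus.lift u + Torus.lift v := rfl
  have hdu : DifferentiableAt ℝ (Torus.lift u) y := (hu1.differentiable (by simp)) y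
  have hdv : DifferentiableAt ℝ (Torus.lift v) y := (hv1.differentiable (by simp)) y
  rw [hl, fderiv_add hdu hdv]
  push_cast
  rw [map_add, hu0 y, hv0 y, add_zero]

section Glue

variable (κ : ℝ) (Q : ShearProfile) (up um : UnitAddTorus (Fin 3) → EuclideanSpace ℝ (Fin 3))

/-- The glued field `u = V₂ + u₊ + u₋`. [ours] -/
def glue : UnitAddTorus (Fin 3) → EuclideanSpace ℝ (Fin 3) := fun x => V2 κ Q x + up x + um x

variable {up um}

/-- `u` is smooth. [ours; elementary] -/
theorem isSmooth_glue (hp : IsSmooth up) (hm : IsSmooth um) : IsSmooth (glue κ Q up um) :=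
  ((isSmooth_V2 κ Q).add hp).add hm

/-- `u` is divergence free. [ours; elementary] -/
theorem isDivFree_glue (hp : IsSmooth up) (hm : IsSmooth um) (hdp : IsDivFree up) (hdm : IsDivFree um) :
    IsDivFree (glue κ Q up um) :=
  isDivFree_add₃ ((isSmooth_V2 κ Q).add hp) hm (isDivFree_add₃ (isSmooth_V2 κ Q) hp (isDivFree_V2 κ Q) hdp) hdm

/-- **The gradient of the glued field is the sum of the three gradients.** [ours; elementary] -/
theorem gradAt_glue (hp : IsSmooth up) (hm : IsSmooth um) (x : UnitAddTorus (Fin 3)) :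
    gradAt (glue κ Q up um) x = fun i j =>
      gradV2 κ (Q.D.onCircle (x 1 + x 2)) (Q.D.onCircle (x 1 - x 2)) i j + gradAt up x i j + gradAt um x i j := by
  funext i j
  have h1 : IsContDiff 1 (V2 κ Q) := isContDiff_V2 κ Q
  have h2 : IsContDiff 1 up := hp.isContDiff (by simp)
  have h3 : IsContDiff 1 um := hm.isContDiff (by simp)
  have e : glue κ Q up um = (V2 κ Q + up) + um := rfl
  simp only [gradAt]
  rw [e, partialDeriv_add (h1.add h2) h3, Pi.add_apply, partialDeriv_add h1 h2, Pi.add_apply]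
  simp only [PiLp.add_apply, partialDeriv_V2_apply, gradV2]

/-- Outside the `+` box the gradient of `u₊` vanishes. [ours; elementary] -/
theorem gradAt_eq_zero_of_not_mem_boxPlus {δ : ℝ} (hup : ∀ y ∉ boxPlus δ, up y = 0) {x : UnitAddTorus (Fin 3)}
    (hx : x ∉ boxPlus δ) : gradAt up x = 0 := by
  funext i j
  simp only [gradAt, partialDeriv_eq_zero_of_not_mem_boxPlus hup hx j]
  rfl

/-- Outside the `−` box the gradient of `u₋` vanishes. [ours; elementary] -/
theorem gradAt_eq_zero_of_not_mem_boxMinus {δ : ℝ} (hum : ∀ y ∉ boxMinus δ, um y = 0) {x : UnitAddTorus (Fin 3)}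
    (hx : x ∉ boxMinus δ) : gradAt um x = 0 := by
  funext i j
  simp only [gradAt, partialDeriv_eq_zero_of_not_mem_boxMinus hum hx j]
  rfl

/-- **The case split at a point** for the glued field (`Q̃' = 1` on the `+` box, `−1` on the `−` box, the boxes
are disjoint and closed, the confined fields have vanishing gradients outside their boxes). [ours] -/
theorem glue_cases {ε δ : ℝ} (hε : 0 < ε) (hε' : ε ≤ 1 / 32) (hδε : ε ≤ δ) (hδ : 0 < δ) (hδ' : δ < 1 / 16)
    (hup : ∀ y ∉ boxPlus (2 * δ), up y = 0) (hum : ∀ y ∉ boxMinus (2 * δ), um y = 0) (x : UnitAddTorus (Fin 3)) :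
    ((wprof hε hε').D.onCircle (x 1 + x 2) = 1 ∧ (wprof hε hε').D.onCircle (x 1 - x 2) = 1 ∧ gradAt um x = 0) ∨
    ((wprof hε hε').D.onCircle (x 1 + x 2) = -1 ∧ (wprof hε hε').D.onCircle (x 1 - x 2) = -1 ∧ gradAt up x = 0) ∨
    (gradAt up x = 0 ∧ gradAt um x = 0) := by
  by_cases hx : x ∈ boxPlus (2 * δ)
  · left
    exact ⟨wprofD_eq_one_of_inArc hε hε' hδε hx.1, wprofD_eq_one_of_inArc hε hε' hδε hx.2,
      gradAt_eq_zero_of_not_mem_boxMinus hum (not_mem_boxMinus_of_mem_boxPlus hδ hδ' hx)⟩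
  by_cases hx' : x ∈ boxMinus (2 * δ)
  · right; left
    exact ⟨wprofD_eq_neg_one_of_inArc hε hε' hδε hx'.1, wprofD_eq_neg_one_of_inArc hε hε' hδε hx'.2,
      gradAt_eq_zero_of_not_mem_boxPlus hup hx⟩
  · right; right
    exact ⟨gradAt_eq_zero_of_not_mem_boxPlus hup hx, gradAt_eq_zero_of_not_mem_boxMinus hum hx'⟩

end Glue

end WrapStretching

end Summit.NavierStokesRegularity.FunctionalMining

end
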